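import Summits.QuantumFields.YangMills.Theorems.ForcedResponseSkewnessFemtoEngineCoarsePin
import HarnessLib

/-!
# Route `ForcedResponseSkewness`: the FINE half of the unit pinning is hyperscaling-weighted clustering (lead `ym-line-frs-p1` g7, 2026-08-28)

Helper file (`--supports stmt-QuantumFields-26871`, also serves 24275), sequel of `…FemtoEngineCoarsePin.lean`.

`FloorPinsFine G r u` (no clause-(i) floor survives in a unit drifting FINER than `u`) follows from ONE torus-level law in the unit `u` with no
test functions: `HyperscalingClustering G r u` — `d⁸·|torusCov β L x y| ≤ ε` once the physical separation `u(β)·d ≥ D(ε)`, uniformly in `β` large and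
large tori (Defs `Theorems/ForcedResponseSkewnessFemtoEngineDefs.lean`).  Mechanism (mirror image of `floorPins_coarse_of_logCeiling`): at a coupling with
`u β > M·a β` every contributing pair of `Q2_{(β,L,aβ)}(θv₀, v₀)` has torus distance `d ≥ 2δ/aβ` (time gap of the witness), i.e. physical `u`-separation
`> 2δM ≥ D`, so `|torusCov| ≤ ε'·(aβ/2δ)⁸` and the lattice `L¹` envelopes give `Q2 ≤ K_θ K_v ε'/(2δ)⁸ < ε` — contradicting the floor on a large torus.

* `floorPinsFine_of_hyperscalingClustering` — `HyperscalingClustering G r u ⇒ FloorPinsFine G r u`;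
* `femtoEngineFineSigR_of_hc : FemtoEngineHCSigR → FemtoEngineFineSigR`, **`femtoEngineSigR_of_hc : FemtoEngineHCSigR → FemtoEngineSigR`** — the route's
  declared debt outside the residual is TWO PHYSICS LAWS IN ONE UNIT per `(G, r)`: the engine laws `FemtoEngineAt` (UV, Bałaban class) and
  `HyperscalingClustering` (IR-light: inside the femto range `d⁸·Cov` is bounded — E0′/`MomentBounds6` —, beyond it it must tend to `0`; weaker than
  exponential clustering with a hyperscaling prefactor, not implied by clustering with a β-independent prefactor).

HONEST LABEL: analysis/bookkeeping on a conditional rung line (leaf R2a `BalabanLadder.NT`); none of the engine laws, `HyperscalingClustering`, the cruxes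
26871/24275, the residual, NT or the Yang–Mills mass gap is proved.
-/

set_option autoImplicit false

noncomputable section

namespace Summit.QuantumFields.YangMills.Cruxes.ResponseLocalisation.FemtoEngine

open scoped SchwartzMap
open MeasureTheory Filter Topology Set Metric
open Literature.MathematicalPhysics.QuantumFieldTheory Literature.MathematicalPhysics.QuantumLattice
open Literature.Probability.LatticeModels
open Summit.QuantumFields.YangMills.Cruxes.OSLegsFromFemtoAndGap.DlrCollarTransfer
open Summit.QuantumFields.YangMills.Cruxes.ResponseLocalisation.Birth
open Summit.QuantumFields.YangMills.Cruxes.RunningCouplingCeiling.Pointwise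
open Summit.QuantumFields.YangMills.Cruxes.NT.Reference (exists_timeGap_of_tsupport_subset)
open Summit.QuantumFields.YangMills.Cruxes.IR.AfOnset (exists_sum_abs_schwartz_lattice_le_div_min)
open Summit.QuantumFields.YangMills.Cruxes.ResponseLocalisation.Femto (abs_apply_le_norm)

variable {G : Type} [Group G] [TopologicalSpace G] [IsTopologicalGroup G] [CompactSpace G]
  [MeasurableSpace G] [BorelSpace G] (r : LatticeRep G)

/-- **Hyperscaling-weighted clustering beyond the femto range pins every floor-carrying unit from below**:
`HyperscalingClustering G r u ⇒ FloorPinsFine G r u`. [folklore] -/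
theorem floorPinsFine_of_hyperscalingClustering {u : ℝ → ℝ} (hu : ∀ β, 0 < u β)
    (hHC : HyperscalingClustering G r u) : FloorPinsFine G r u := by
  intro a ha ha0 hfloor
  obtain ⟨v₀, ε, β₅, Λ₅, hK, hpos, hε, hfl⟩ := hfloor
  -- support radius and time gap of the witness
  obtain ⟨σ₀, hvσ₀⟩ := hK.isCompact.isBounded.subset_closedBall (0 : EuclideanSpace ℝ (Fin 4))
  obtain ⟨σ, hσ, hvσ⟩ : ∃ σ : ℝ, 0 < σ ∧ tsupport (v₀ : EuclideanSpace ℝ (Fin 4) → ℝ) ⊆ closedBall 0 σ :=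
    ⟨max σ₀ 1, lt_of_lt_of_le one_pos (le_max_right _ _), hvσ₀.trans (closedBall_subset_closedBall (le_max_left _ _))⟩
  obtain ⟨δ, hδ, hvδ⟩ := exists_timeGap_of_tsupport_subset hpos hvσ
  -- lattice L¹ envelopes
  obtain ⟨Kv, hKv0, hKv⟩ := exists_sum_abs_schwartz_lattice_le_div_min v₀
  obtain ⟨Kθ, hKθ0, hKθ⟩ := exists_sum_abs_schwartz_lattice_le_div_min (thetaTest 4 v₀)
  -- the clustering tolerance `ε'` with `Kθ Kv ε'/(2δ)⁸ < ε`
  obtain ⟨ε', hε', hε'small⟩ : ∃ ε' : ℝ, 0 < ε' ∧ Kθ * Kv * ε' / (2 * δ) ^ 8 < ε := by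
    refine ⟨ε * (2 * δ) ^ 8 / (2 * (Kθ * Kv + 1)), by positivity, ?_⟩
    have h1 : Kθ * Kv * (ε * (2 * δ) ^ 8 / (2 * (Kθ * Kv + 1))) / (2 * δ) ^ 8 = ε * (Kθ * Kv / (2 * (Kθ * Kv + 1))) := by
      field_simp
    rw [h1]
    have h2 : Kθ * Kv / (2 * (Kθ * Kv + 1)) < 1 := by
      rw [div_lt_one (by positivity)]; nlinarith [mul_nonneg hKθ0 hKv0]
    calc ε * (Kθ * Kv / (2 * (Kθ * Kv + 1))) < ε * 1 := mul_lt_mul_of_pos_left h2 hε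
      _ = ε := mul_one ε
  obtain ⟨D, β₀, Λ₀, HHC⟩ := hHC ε' hε'
  -- the constant
  set M : ℝ := max (D / (2 * δ)) 1 with hM
  have hM0 : 0 < M := lt_of_lt_of_le one_pos (le_max_right _ _)
  have hMD : D ≤ 2 * δ * M := by
    have h1 : D / (2 * δ) ≤ M := le_max_left _ _
    rw [div_le_iff₀ (by positivity)] at h1; linarith
  refine ⟨M, ?_⟩
  -- thresholds in β
  have hsmall : ∀ᶠ β in atTop, a β ≤ 1 := (ha0.eventually (Iic_mem_nhds one_pos)).mono fun β h => h
  filter_upwards [hsmall, eventually_ge_atTop β₅, eventually_ge_atTop β₀] with β ha1 hβ₅ hβ₀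
  have haβ := ha β
  have huβ := hu β
  by_contra hlt
  have hlt' : M * a β < u β := lt_of_not_ge hlt
  -- a large torus
  obtain ⟨L, hL5, hL0, hLσ⟩ : ∃ L : ℕ, Λ₅ ≤ a β * L ∧ Λ₀ ≤ u β * L ∧ 2 * σ / a β ≤ L := by
    refine ⟨⌈max (max (Λ₅ / a β) (Λ₀ / u β)) (2 * σ / a β)⌉₊, ?_, ?_, ?_⟩
    · have h1 : Λ₅ / a β ≤ ⌈max (max (Λ₅ / a β) (Λ₀ / u β)) (2 * σ / a β)⌉₊ :=
        ((le_max_left _ _).trans (le_max_left _ _)).trans (Nat.le_ceil _)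
      rw [div_le_iff₀ haβ] at h1; linarith
    · have h1 : Λ₀ / u β ≤ ⌈max (max (Λ₅ / a β) (Λ₀ / u β)) (2 * σ / a β)⌉₊ :=
        ((le_max_right _ _).trans (le_max_left _ _)).trans (Nat.le_ceil _)
      rw [div_le_iff₀ huβ] at h1; linarith
    · exact (le_max_right _ _).trans (Nat.le_ceil _)
  -- the floor on this torus
  have hfloorβ := hfl β hβ₅ L hL5
  rw [Q2_eq_sum_torusCov] at hfloorβ
  -- the pair bound `|torusCov x y| ≤ P` on contributing pairs
  set P : ℝ := ε' / (2 * δ / a β) ^ 8 with hP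
  have hP0 : 0 ≤ P := by positivity
  have pair : ∀ x ∈ box 4 L, ∀ y ∈ box 4 L,
      |thetaTest 4 v₀ (a β • siteToE x)| * |v₀ (a β • siteToE y)| * |torusCov G r β L x y| ≤
        |thetaTest 4 v₀ (a β • siteToE x)| * |v₀ (a β • siteToE y)| * P := by
    intro x hx y hy
    by_cases hx0 : thetaTest 4 v₀ (a β • siteToE x) = 0
    · simp [hx0]
    by_cases hy0 : v₀ (a β • siteToE y) = 0
    · simp [hy0]
    apply mul_le_mul_of_nonneg_left _ (by positivity)
    have hx0' : v₀ (timeReflection 4 (a β • siteToE x)) ≠ 0 := by rwa [thetaTest_apply] at hx0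
    -- geometry of the contributing pair
    have hyt : δ ≤ a β * (y 0 : ℝ) := by
      have h := hvδ _ hy0
      rwa [Summit.QuantumFields.YangMills.Cruxes.NT.Reference.smul_siteToE_apply_zero] at h
    have hxt : a β * (x 0 : ℝ) ≤ -δ := by
      have h := hvδ _ hx0'
      rw [timeReflection_apply, if_pos rfl,
        Summit.QuantumFields.YangMills.Cruxes.NT.Reference.smul_siteToE_apply_zero] at h
      linarith
    have hny : a β * ‖siteToE y‖ ≤ σ := by
      have h1 := norm_smul_le_of_ne_zero hvσ hy0
      rwa [norm_smul, Real.norm_of_nonneg haβ.le] at h1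
    have hnx : a β * ‖siteToE x‖ ≤ σ := by
      have h1 := norm_smul_le_of_ne_zero hvσ hx0'
      rwa [LinearIsometryEquiv.norm_map, norm_smul, Real.norm_of_nonneg haβ.le] at h1
    have hyσ : a β * |((y 0 : ℤ) : ℝ)| ≤ σ :=
      le_trans (mul_le_mul_of_nonneg_left (abs_apply_le_norm y 0) haβ.le) hny
    have hxσ : a β * |((x 0 : ℤ) : ℝ)| ≤ σ :=
      le_trans (mul_le_mul_of_nonneg_left (abs_apply_le_norm x 0) haβ.le) hnx
    -- torus distance of the pair: at least `2δ/aβ`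
    have hgap : 2 * δ ≤ a β * (((y 0 : ℤ) : ℝ) - ((x 0 : ℤ) : ℝ)) := by
      have : a β * (((y 0 : ℤ) : ℝ) - ((x 0 : ℤ) : ℝ)) = a β * (y 0 : ℝ) - a β * (x 0 : ℝ) := by ring
      rw [this]; linarith
    have hdiff_pos : 0 < ((y 0 : ℤ) : ℝ) - ((x 0 : ℤ) : ℝ) := by
      by_contra hneg
      have : a β * (((y 0 : ℤ) : ℝ) - ((x 0 : ℤ) : ℝ)) ≤ 0 :=
        mul_nonpos_of_nonneg_of_nonpos haβ.le (not_lt.mp hneg)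
      linarith
    have habs : (|x 0 - y 0| : ℝ) = ((y 0 : ℤ) : ℝ) - ((x 0 : ℤ) : ℝ) := by
      rw [abs_sub_comm, abs_of_pos hdiff_pos]
    have hdlow : 2 * δ / a β ≤ torusDist L x y := by
      have h1 : 2 * δ / a β ≤ (|x 0 - y 0| : ℝ) := by
        rw [habs, div_le_iff₀ haβ]; linarith [hgap]
      have h3 : |x 0 - y 0| ≤ (L : ℤ) := by
        have h4 : (|x 0 - y 0| : ℝ) ≤ L := by
          rw [habs]
          have h5 : ((y 0 : ℤ) : ℝ) ≤ |((y 0 : ℤ) : ℝ)| := le_abs_self _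
          have h6 : -((x 0 : ℤ) : ℝ) ≤ |((x 0 : ℤ) : ℝ)| := neg_le_abs _
          have h7 : a β * (|((y 0 : ℤ) : ℝ)| + |((x 0 : ℤ) : ℝ)|) ≤ 2 * σ := by linarith
          have h8 : |((y 0 : ℤ) : ℝ)| + |((x 0 : ℤ) : ℝ)| ≤ 2 * σ / a β := by
            rw [le_div_iff₀ haβ, mul_comm]; exact h7
          linarith
        exact_mod_cast h4
      exact h1.trans (abs_sub_le_torusDist L x y h3)
    have hd0 : 0 < torusDist L x y := lt_of_lt_of_le (by positivity) hdlow
    -- hypothesis of the clustering law: physical `u`-separation at least `D`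
    have hD : D ≤ u β * torusDist L x y := by
      have h1 : 2 * δ * M ≤ u β * (2 * δ / a β) := by
        rw [mul_div_assoc', le_div_iff₀ haβ]; nlinarith
      exact hMD.trans (h1.trans (mul_le_mul_of_nonneg_left hdlow huβ.le))
    have hHCxy := HHC β hβ₀ L hL0 x hx y hy hD
    have hC0 : |torusCov G r β L x y| ≤ ε' / torusDist L x y ^ 8 := by
      rw [le_div_iff₀ (by positivity)]
      calc |torusCov G r β L x y| * torusDist L x y ^ 8 = torusDist L x y ^ 8 * |torusCov G r β L x y| := by ring
        _ ≤ ε' := hHCxy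
    calc |torusCov G r β L x y| ≤ ε' / torusDist L x y ^ 8 := hC0
      _ ≤ P := by
          apply div_le_div_of_nonneg_left hε'.le (by positivity)
          exact pow_le_pow_left₀ (by positivity) hdlow 8
  -- summing up
  have hsum : ∑ x ∈ box 4 L, ∑ y ∈ box 4 L,
      thetaTest 4 v₀ (a β • siteToE x) * v₀ (a β • siteToE y) * torusCov G r β L x y ≤ Kθ * Kv * ε' / (2 * δ) ^ 8 := by
    calc ∑ x ∈ box 4 L, ∑ y ∈ box 4 L, thetaTest 4 v₀ (a β • siteToE x) * v₀ (a β • siteToE y) * torusCov G r β L x y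
        ≤ ∑ x ∈ box 4 L, ∑ y ∈ box 4 L,
            |thetaTest 4 v₀ (a β • siteToE x)| * |v₀ (a β • siteToE y)| * P := by
          refine Finset.sum_le_sum fun x hx => Finset.sum_le_sum fun y hy => ?_
          refine le_trans (le_abs_self _) ?_
          rw [abs_mul, abs_mul]
          exact pair x hx y hy
      _ = (∑ x ∈ box 4 L, |thetaTest 4 v₀ (a β • siteToE x)|) * (∑ y ∈ box 4 L, |v₀ (a β • siteToE y)|) * P := by
          rw [Finset.sum_mul_sum, Finset.sum_mul]
          simp_rw [Finset.sum_mul]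
      _ ≤ (Kθ / (min (a β) 1) ^ 4) * (Kv / (min (a β) 1) ^ 4) * P := by
          apply mul_le_mul_of_nonneg_right _ hP0
          exact mul_le_mul (hKθ _ haβ _) (hKv _ haβ _) (Finset.sum_nonneg fun _ _ => abs_nonneg _)
            (div_nonneg hKθ0 (by positivity))
      _ = Kθ * Kv * ε' / (2 * δ) ^ 8 := by
          rw [min_eq_left ha1, hP, div_pow]
          field_simp
  linarith

omit [MeasurableSpace G] [BorelSpace G] in
/-- `FemtoEngineHCSigR → FemtoEngineFineSigR`. [folklore] -/
theorem femtoEngineFineSigR_of_hc (hH : FemtoEngineHCSigR) : FemtoEngineFineSigR := by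
  intro G _ _ _ _ hG
  letI : MeasurableSpace G := borel G
  haveI : BorelSpace G := ⟨rfl⟩
  intro r
  obtain ⟨u, hu, hu0, hE, hC⟩ := hH G hG r
  exact ⟨u, hu, hu0, hE, floorPinsFine_of_hyperscalingClustering r hu hC⟩

omit [MeasurableSpace G] [BorelSpace G] in
/-- **Engine laws ∧ hyperscaling clustering in ONE unit per `(G, r)` imply the registered interface**:
`FemtoEngineHCSigR → FemtoEngineSigR`.  Nothing of either law is proved. [folklore] -/
theorem femtoEngineSigR_of_hc (hH : FemtoEngineHCSigR) : FemtoEngineSigR :=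
  femtoEngineSigR_of_fine (femtoEngineFineSigR_of_hc hH)

end Summit.QuantumFields.YangMills.Cruxes.ResponseLocalisation.FemtoEngine

end
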